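/-
Origin: expansion seat `planner-pub-hodgecm-pv11-g5-0`, handover #5 2026-08-18T08:32:06Z (`HOME/pub-hodgecm-pv11-g5/lean/Pv11g5/RealPlaceCircles.lean`, md5 1ac46477, 271 lines);
landed by the gen-7 packager in gate run 27 as `HodgeCM/PerL34/RealPlaceCircles.lean` (import ^import Pv[0-9]+g[0-9]+\.→import HodgeCM.PerL34. ×1).
-/
/-
Origin: planner-pub-hodgecm-pv11-g5-0 (unit pub-hodgecm-pv11-g5, DAG-NODE PROVER #11 gen 5), HodgeCM publication cell,
2026-08-18.  Node 5 of this seat: the REAL-PLACE CIRCLES `U(W_{i,b}) = U(1) → U(W_i)(𝔸) → [U(W_i)]` of PerL §4.1 in the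
GENUINE idelic model, and the junction between the archimedean data of N27 (L4.1(a), `HodgeCM.PerL34.ArchA`) and
the archimedean TYPES of N30 (L4.2(a), nodes 1/3/4 of this seat).  Mathlib + landed tree + this seat's nodes only;
nothing cited, nothing posited.
-/
import Summits.HodgeConjecture.HodgeCM.PerL34.SeesawChars_2

/-!
# Real-place circles of `U(W_i)(𝔸)` in the genuine model (CM extension `L / L⁺`)

PerL v5 §4.1 works, for a hermitian LINE `W_i` over the CM extension `L/L₀`, with the compact automorphic quotient
`[U(W_i)] = U(W_i)(L₀)\U(W_i)(𝔸)` and, at every real place `b` of `L₀`, with the circle `U(W_{i,b}) = U(1)`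
(tex l. 476: "$\U(W_{i,b})=\U(1)$ acts on it by a character $u\mapsto u^{-e_b(\Psi_i)}$, which \emph{defines} $e_b(\Psi_i)\in\Z$")
and the local component `χ'_{i,b}` of an automorphic character `χ'_i` of `[U(W_i)]` (tex l. 481, Lemma 4.1(a):
"then $\chi'_{i,b}(u)=u^{e_b(\Psi_i)}$ for all $b$").  The landed rendering of Lemma 4.1(a)
(`HodgeCM.PerL34.ArchA.LineArchData`, pv02) keeps these as abstract DATA: a compact group `Q` (= `[U(W_i)]`),
homomorphisms `toQ : RealPl → (Circle →* Q)` (the images of the real-place circles) and characters `χQ χ : Q →* Circle`,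
with `loc χ b := (χQ χ).comp (toQ b)` and `LocMatches χ := ∀ b u, (loc χ b u : ℂ) = (u : ℂ) ^ e b`.

This file supplies that torus-side data for PerL's GENUINE objects — `U(W_i)(𝔸) = U(1)_{L/L⁺}(𝔸_{L⁺}) =
relNormOneIdeles L⁺ L` (pv11-g4), `[U(W_i)] = relNormOneIdeles L⁺ L ⧸ relNormOneRat L⁺ L`, `RealPl := InfinitePlace L⁺`
(the real places `b` of `L₀ = L⁺`; `L⁺` is totally real) — and proves that `LocMatches` is then literally the
archimedean-type condition `HasArchType` of nodes 1/3/4: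

* `realPlaceCircle L b : Circle →* relNormOneIdeles L⁺ L` — the circle `U(W_{i,b}) = U(1)` at the real place `b`
  embedded in `U(W_i)(𝔸)`: the idele of relative norm one whose component at THE infinite place `w_b` of `L` above `b`
  (Mathlib `NumberField.IsCMField.equivInfinitePlace L : InfinitePlace L ≃ InfinitePlace L⁺`) is `u`, all other
  archimedean components `1`, finite component `1` (`coe_realPlaceCircle_snd`); continuous (`continuous_realPlaceCircle`).
* `realPlaceCircleQuot L b : Circle →* [U(W_i)]` — its class (= `toQ b := mk ∘ ι b`), continuous.
* `forall_realPlaceCircle_iff_hasArchType` — for a continuous unitary character `χ` of `[U(W_i)]` and `e : RealPl → ℤ`: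
  `(∀ b u, ((χ ∘ realPlaceCircleQuot L b) u : ℂ) = (u : ℂ) ^ (e b)) ↔ HasArchType L χ (e ∘ equivInfinitePlace)`,
  i.e. `LocMatches` (for `toQ := realPlaceCircleQuot L`, `χQ := (·)`) IS "`χ` has archimedean type `e`".
* `exists_char_forall_realPlaceCircle` — for every `e` such a `χ` EXISTS (PerL Lemma 4.2(a), node 3,
  `NumberField.exists_pontryaginDual_hasArchType`), and `eq_of_forall_realPlaceCircle` — `e` is determined by `χ` (node 4).
* `SeesawTorus.mem_allowedChars_iff_forall_realPlaceCircle` — for PerL's seesaw torus `T = U(W₁)(𝔸) × U(W₂)(𝔸)`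
  (node 1) the characters of `[T]` of archimedean type `(m₁, m₂)` (node 4's index set `allowedChars`; NOT PerL Def. 3.2 allowedness) are exactly the `ξ` which are
  `u ↦ u ^ (m₁ w_b)` on the real-place circles of the first factor and `u ↦ u ^ (m₂ w_b)` on those of the second.
-/

set_option autoImplicit false

noncomputable section

open Topology Set Function

namespace NumberField

open IsDedekindDomain
open Literature.NumberTheory Literature.NumberTheory.Automorphic

variable (L : Type) [Field L] [NumberField L] [IsCMField L]

local notation "L⁺" => maximalRealSubfield L

/-! ## §1  Continuity of the one-place subtori -/

open scoped Classical in
/-- The one-place subtorus `archCoord L w : S¹ →* U(1)(L⁺ ⊗ ℝ)` (node 4) is continuous. -/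
theorem continuous_archCoord (w : InfinitePlace L) : Continuous (archCoord L w) :=
  (unitaryLineArchTorusContinuousMulEquiv L).symm.continuous.comp (continuous_mulSingle (A := fun _ : InfinitePlace L => Circle) w)

/-- `archCoord L w` as a continuous homomorphism. -/
def archCoordCont (w : InfinitePlace L) : Circle →ₜ* unitaryLineArchTorus L :=
  { archCoord L w with continuous_toFun := continuous_archCoord L w }

/-- (Ported verbatim from the HodgeCMPerL package; no docstring in the source.) -/
@[simp] theorem archCoordCont_apply (w : InfinitePlace L) (u : Circle) : archCoordCont L w u = archCoord L w u := rfl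

/-! ## §2  The real-place circles `U(W_{i,b}) → U(W_i)(𝔸)` and `→ [U(W_i)]` -/

/-- THE infinite place of the CM field `L` above the real place `b` of `L⁺` (Mathlib: every infinite place of `L⁺`
has exactly one place of `L` above it, `IsCMField.equivInfinitePlace`). -/
abbrev placeAbove (b : InfinitePlace L⁺) : InfinitePlace L := (IsCMField.equivInfinitePlace L).symm b

/-- (Ported verbatim from the HodgeCMPerL package; no docstring in the source.) -/
@[simp] theorem equivInfinitePlace_placeAbove (b : InfinitePlace L⁺) :
    IsCMField.equivInfinitePlace L (placeAbove L b) = b := Equiv.apply_symm_apply _ _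

/-- (Ported verbatim from the HodgeCMPerL package; no docstring in the source.) -/
@[simp] theorem placeAbove_equivInfinitePlace (w : InfinitePlace L) :
    placeAbove L (IsCMField.equivInfinitePlace L w) = w := Equiv.symm_apply_apply _ _

/-- **The real-place circle** `U(W_{i,b}) = U(1) → U(W_i)(𝔸) = U(1)_{L/L⁺}(𝔸_{L⁺})` at the real place `b` of `L₀ = L⁺`:
`u ↦` the norm-one idele with `w_b`-component `u`, all other components `1`. -/
def realPlaceCircle (b : InfinitePlace L⁺) : Circle →* relNormOneIdeles L⁺ L :=
  (relNormOneInfToIdeles L⁺ L).comp (archCoord L (placeAbove L b))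

/-- (Ported verbatim from the HodgeCMPerL package; no docstring in the source.) -/
theorem realPlaceCircle_apply (b : InfinitePlace L⁺) (u : Circle) :
    realPlaceCircle L b u = relNormOneInfToIdeles L⁺ L (archCoord L (placeAbove L b) u) := rfl

/-- (Ported verbatim from the HodgeCMPerL package; no docstring in the source.) -/
theorem continuous_realPlaceCircle (b : InfinitePlace L⁺) : Continuous (realPlaceCircle L b) :=
  (continuous_relNormOneInfToIdeles L⁺ L).comp (continuous_archCoord L _)

/-- `realPlaceCircle L b` as a continuous homomorphism `S¹ →ₜ* U(W_i)(𝔸)`. -/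
def realPlaceCircleCont (b : InfinitePlace L⁺) : Circle →ₜ* relNormOneIdeles L⁺ L :=
  { realPlaceCircle L b with continuous_toFun := continuous_realPlaceCircle L b }

/-- (Ported verbatim from the HodgeCMPerL package; no docstring in the source.) -/
@[simp] theorem realPlaceCircleCont_apply (b : InfinitePlace L⁺) (u : Circle) :
    realPlaceCircleCont L b u = realPlaceCircle L b u := rfl

/-- The real-place circles live in the archimedean component: the FINITE-adelic component of `realPlaceCircle L b u`
is `1`. -/
theorem coe_realPlaceCircle_snd (b : InfinitePlace L⁺) (u : Circle) :
    (((realPlaceCircle L b u : relNormOneIdeles L⁺ L) : ideleGroup L) : AdeleRing (𝓞 L) L).2 = 1 := by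
  rw [realPlaceCircle_apply, coe_relNormOneInfToIdeles, coe_infUnitsToIdele]

/-- ... and its ARCHIMEDEAN component is the element `archCoord L w_b u` of `U(1)(L⁺ ⊗ ℝ) ≤ (L ⊗ ℝ)ˣ`. -/
theorem coe_realPlaceCircle_fst (b : InfinitePlace L⁺) (u : Circle) :
    (((realPlaceCircle L b u : relNormOneIdeles L⁺ L) : ideleGroup L) : AdeleRing (𝓞 L) L).1 =
      ((archCoord L (placeAbove L b) u : unitaryLineArchTorus L) : (InfiniteAdeleRing L)ˣ) := by
  rw [realPlaceCircle_apply, coe_relNormOneInfToIdeles, coe_infUnitsToIdele]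

open scoped Classical in
/-- The per-place unitary characters of the archimedean component of `realPlaceCircle L b u`: `u` at `w_b`, `1` elsewhere. -/
theorem archPlaceChars_realPlaceCircle (b : InfinitePlace L⁺) (u : Circle) (w : InfinitePlace L) :
    archPlaceChars L (archCoord L (placeAbove L b) u) w = if w = placeAbove L b then u else 1 := by
  rw [archPlaceChars_archCoord]
  by_cases h : w = placeAbove L b
  · subst h; rw [Pi.mulSingle_eq_same, if_pos rfl]
  · rw [Pi.mulSingle_eq_of_ne h, if_neg h]

/-- **The real-place circles generate the archimedean torus**: the image of `t ∈ U(1)(L⁺ ⊗ ℝ)` in `U(W_i)(𝔸)` is the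
(finite, commuting) product over the real places `b` of the circle elements with parameter `t_{w_b}`. -/
theorem relNormOneInfToIdeles_eq_prod_realPlaceCircle (t : unitaryLineArchTorus L) :
    relNormOneInfToIdeles L⁺ L t = ∏ b : InfinitePlace L⁺, realPlaceCircle L b (archPlaceChars L t (placeAbove L b)) := by
  -- `U(W_j)(L₀ ⊗ ℝ) := relNormOneInfUnits L⁺ L` is a `def` (pv11-g4); retype the inclusion so that `map_prod` elaborates.
  let ι : unitaryLineArchTorus L →* relNormOneIdeles L⁺ L := relNormOneInfToIdeles L⁺ L
  change ι t = ∏ b : InfinitePlace L⁺, ι (archCoord L (placeAbove L b) (archPlaceChars L t (placeAbove L b)))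
  conv_lhs => rw [eq_prod_archCoord L t]
  rw [map_prod]
  exact ((IsCMField.equivInfinitePlace L).symm.prod_comp (fun w => ι (archCoord L w (archPlaceChars L t w)))).symm

/-- **The class of the real-place circle in `[U(W_i)]`**: `toQ b := cl ∘ ι_b : U(W_{i,b}) → [U(W_i)]`. -/
def realPlaceCircleQuot (b : InfinitePlace L⁺) : Circle →* relNormOneIdeles L⁺ L ⧸ relNormOneRat L⁺ L :=
  (QuotientGroup.mk' (relNormOneRat L⁺ L)).comp (realPlaceCircle L b)

/-- (Ported verbatim from the HodgeCMPerL package; no docstring in the source.) -/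
theorem realPlaceCircleQuot_apply (b : InfinitePlace L⁺) (u : Circle) :
    realPlaceCircleQuot L b u = (QuotientGroup.mk (realPlaceCircle L b u) : _ ⧸ relNormOneRat L⁺ L) := rfl

/-- Dictionary with nodes 1/4: the class of the real-place circle is `cl_j ∘ archCoord` at the place above `b`. -/
theorem realPlaceCircleQuot_eq_archToQuot (b : InfinitePlace L⁺) (u : Circle) :
    realPlaceCircleQuot L b u = SeesawTorus.unitaryLineArchToQuot L (archCoord L (placeAbove L b) u) := rfl

/-- `cl_j(t)` is the product of the classes of the real-place circle elements of `t`. -/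
theorem unitaryLineArchToQuot_eq_prod_realPlaceCircleQuot (t : unitaryLineArchTorus L) :
    SeesawTorus.unitaryLineArchToQuot L t =
      ∏ b : InfinitePlace L⁺, realPlaceCircleQuot L b (archPlaceChars L t (placeAbove L b)) := by
  change (QuotientGroup.mk' (relNormOneRat L⁺ L)) (relNormOneInfToIdeles L⁺ L t) = _
  rw [relNormOneInfToIdeles_eq_prod_realPlaceCircle, map_prod]
  rfl

/-- (Ported verbatim from the HodgeCMPerL package; no docstring in the source.) -/
theorem continuous_realPlaceCircleQuot (b : InfinitePlace L⁺) : Continuous (realPlaceCircleQuot L b) :=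
  QuotientGroup.continuous_mk.comp (continuous_realPlaceCircle L b)

/-- `realPlaceCircleQuot L b` as a continuous homomorphism `S¹ →ₜ* [U(W_i)]`. -/
def realPlaceCircleQuotCont (b : InfinitePlace L⁺) : Circle →ₜ* relNormOneIdeles L⁺ L ⧸ relNormOneRat L⁺ L :=
  { realPlaceCircleQuot L b with continuous_toFun := continuous_realPlaceCircleQuot L b }

/-- (Ported verbatim from the HodgeCMPerL package; no docstring in the source.) -/
@[simp] theorem realPlaceCircleQuotCont_apply (b : InfinitePlace L⁺) (u : Circle) :
    realPlaceCircleQuotCont L b u = realPlaceCircleQuot L b u := rfl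

/-! ## §3  `LocMatches` ↔ `HasArchType`: the N27/N30 junction -/

namespace SeesawTorus

variable {L}

/-- **The local component `χ'_{i,b} := χ' ∘ toQ b` is `u ↦ u ^ (e b)` at every real place `b` iff `χ'` has archimedean
type `e`** (types of nodes 1/3/4 are indexed by the infinite places `w` of `L`; `e ∘ equivInfinitePlace` re-indexes by
`w ↦ w|_{L⁺}`).  This is `ArchA.LineArchData.LocMatches` for `Q := [U(W_i)]`, `toQ := realPlaceCircleQuot L`,
`χQ := (·)` — stated with the `ℂ`-valued equation exactly as in `LocMatches`. -/
theorem forall_realPlaceCircle_iff_hasArchType (χ : PontryaginDual (relNormOneIdeles L⁺ L ⧸ relNormOneRat L⁺ L))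
    (e : InfinitePlace L⁺ → ℤ) :
    (∀ (b : InfinitePlace L⁺) (u : Circle),
        (((χ : (relNormOneIdeles L⁺ L ⧸ relNormOneRat L⁺ L) →* Circle).comp (realPlaceCircleQuot L b) u : Circle) : ℂ) =
          (u : ℂ) ^ (e b)) ↔
      HasArchType L χ (e ∘ IsCMField.equivInfinitePlace L) := by
  rw [← forall_realPlace_iff_hasArchType]
  refine forall_congr' fun b => forall_congr' fun u => ?_
  rw [MonoidHom.comp_apply, realPlaceCircleQuot_eq_archToQuot, ← Circle.coe_zpow]
  exact ⟨fun h => Subtype.val_injective h, fun h => congrArg Subtype.val h⟩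

/-- The same junction with the `Circle`-valued equation. -/
theorem forall_realPlaceCircle_iff_hasArchType' (χ : PontryaginDual (relNormOneIdeles L⁺ L ⧸ relNormOneRat L⁺ L))
    (e : InfinitePlace L⁺ → ℤ) :
    (∀ (b : InfinitePlace L⁺) (u : Circle), χ (realPlaceCircleQuot L b u) = u ^ (e b)) ↔
      HasArchType L χ (e ∘ IsCMField.equivInfinitePlace L) :=
  forall_realPlace_iff_hasArchType χ e

/-- Indexing by the places of `L` instead: `χ' ∘ toQ (w|_{L⁺}) = (u ↦ u ^ (m w))` for all `w` iff `χ'` has type `m`. -/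
theorem forall_place_realPlaceCircle_iff_hasArchType (χ : PontryaginDual (relNormOneIdeles L⁺ L ⧸ relNormOneRat L⁺ L))
    (m : InfinitePlace L → ℤ) :
    (∀ (w : InfinitePlace L) (u : Circle),
        χ (realPlaceCircleQuot L (IsCMField.equivInfinitePlace L w) u) = u ^ (m w)) ↔ HasArchType L χ m := by
  rw [hasArchType_iff_forall_place]
  refine forall_congr' fun w => forall_congr' fun u => ?_
  rw [realPlaceCircleQuot_eq_archToQuot, placeAbove_equivInfinitePlace]

/-- **Supply (PerL Lemma 4.2(a), node 3) in the `LocMatches` shape**: for every `e : RealPl → ℤ` there is a continuous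
unitary character `χ'` of `[U(W_i)]` with `χ'_{i,b}(u) = u ^ (e b)` at every real place `b`. -/
theorem exists_char_forall_realPlaceCircle (e : InfinitePlace L⁺ → ℤ) :
    ∃ χ : PontryaginDual (relNormOneIdeles L⁺ L ⧸ relNormOneRat L⁺ L),
      ∀ (b : InfinitePlace L⁺) (u : Circle),
        (((χ : (relNormOneIdeles L⁺ L ⧸ relNormOneRat L⁺ L) →* Circle).comp (realPlaceCircleQuot L b) u : Circle) : ℂ) =
          (u : ℂ) ^ (e b) := by
  obtain ⟨χ, hχ⟩ := NumberField.exists_pontryaginDual_hasArchType L (e ∘ IsCMField.equivInfinitePlace L)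
  exact ⟨χ, (forall_realPlaceCircle_iff_hasArchType χ e).mpr hχ⟩

/-- `Circle`-valued form of the supply. -/
theorem exists_char_forall_realPlaceCircle' (e : InfinitePlace L⁺ → ℤ) :
    ∃ χ : PontryaginDual (relNormOneIdeles L⁺ L ⧸ relNormOneRat L⁺ L),
      ∀ (b : InfinitePlace L⁺) (u : Circle), χ (realPlaceCircleQuot L b u) = u ^ (e b) := by
  obtain ⟨χ, hχ⟩ := NumberField.exists_pontryaginDual_hasArchType L (e ∘ IsCMField.equivInfinitePlace L)
  exact ⟨χ, (forall_realPlaceCircle_iff_hasArchType' χ e).mpr hχ⟩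

/-- **The exponents `e_b` are determined by `χ'`** (node 4, `HasArchType.unique`): if `χ'_{i,b}(u) = u ^ (e b)` and
`= u ^ (e' b)` for all `b, u` then `e = e'`. -/
theorem eq_of_forall_realPlaceCircle (χ : PontryaginDual (relNormOneIdeles L⁺ L ⧸ relNormOneRat L⁺ L))
    {e e' : InfinitePlace L⁺ → ℤ} (h : ∀ (b : InfinitePlace L⁺) (u : Circle), χ (realPlaceCircleQuot L b u) = u ^ (e b))
    (h' : ∀ (b : InfinitePlace L⁺) (u : Circle), χ (realPlaceCircleQuot L b u) = u ^ (e' b)) : e = e' := by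
  have he := (forall_realPlaceCircle_iff_hasArchType' χ e).mp h
  have he' := (forall_realPlaceCircle_iff_hasArchType' χ e').mp h'
  have := HasArchType.unique he he'
  funext b
  have hb := congrFun this ((IsCMField.equivInfinitePlace L).symm b)
  simpa only [Function.comp_apply, Equiv.apply_symm_apply] using hb

/-- The real-place exponents of a continuous unitary character `χ'` of `[U(W_i)]`, when they exist, are UNIQUE
(that every `χ'` has SOME exponent vector is the classification of the continuous characters of `U(1)(L⁺ ⊗ ℝ) ≅ ∏_b S¹`,
not needed by PerL and not proved here; uniqueness is what nodes 1/4 give unconditionally). -/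
theorem subsingleton_realPlaceExponents (χ : PontryaginDual (relNormOneIdeles L⁺ L ⧸ relNormOneRat L⁺ L)) :
    Set.Subsingleton {e : InfinitePlace L⁺ → ℤ | ∀ (b : InfinitePlace L⁺) (u : Circle), χ (realPlaceCircleQuot L b u) = u ^ (e b)} :=
  fun _ he _ he' => eq_of_forall_realPlaceCircle χ he he'

/-! ## §4  The seesaw torus `T = U(W₁)(𝔸) × U(W₂)(𝔸)`: the characters of type `(m₁, m₂)` through the real-place circles -/

/-- **The characters of `[T]` of type `(m₁, m₂)`, per real place** (node 4's index set `allowedChars` = `X` of ll. 398–400; not Def. 3.2 allowedness): a continuous unitary character `ξ` of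
`[T] = T(L₀)\T(𝔸)` has archimedean type `(m₁, m₂)` iff on the real-place circles of the FIRST factor it is
`u ↦ u ^ (m₁ w_b)` and on those of the SECOND factor `u ↦ u ^ (m₂ w_b)` (types indexed by the places `w` of `L`,
`b = w|_{L⁺}`). -/
theorem mem_allowedChars_iff_forall_realPlaceCircle (ξ : PontryaginDual (SeesawTorus L⁺ L ⧸ rat L⁺ L))
    (m₁ m₂ : InfinitePlace L → ℤ) :
    ξ ∈ allowedChars L m₁ m₂ ↔
      (∀ (w : InfinitePlace L) (u : Circle),
          ξ (QuotientGroup.mk (inl L⁺ L (realPlaceCircle L (IsCMField.equivInfinitePlace L w) u))) = u ^ (m₁ w)) ∧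
        ∀ (w : InfinitePlace L) (u : Circle),
          ξ (QuotientGroup.mk (inr L⁺ L (realPlaceCircle L (IsCMField.equivInfinitePlace L w) u))) = u ^ (m₂ w) := by
  rw [mem_allowedChars, ← forall_place_realPlaceCircle_iff_hasArchType, ← forall_place_realPlaceCircle_iff_hasArchType]
  exact Iff.rfl

/-- The character `χ′₁ ⊠ χ′₂` of `[T]` on the real-place circles of the two factors. -/
theorem charPair_mk_inl_realPlaceCircle (ξ₁ ξ₂ : PontryaginDual (relNormOneIdeles L⁺ L ⧸ relNormOneRat L⁺ L))
    (b : InfinitePlace L⁺) (u : Circle) :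
    charPair ξ₁ ξ₂ (QuotientGroup.mk (inl L⁺ L (realPlaceCircle L b u))) = ξ₁ (realPlaceCircleQuot L b u) := by
  change charPair ξ₁ ξ₂ (QuotientGroup.mk (mk L⁺ L (realPlaceCircle L b u) 1)) = _
  rw [charPair_mk, show (QuotientGroup.mk (1 : relNormOneIdeles L⁺ L) : _ ⧸ relNormOneRat L⁺ L) = 1 from rfl, map_one,
    mul_one]
  rfl

/-- (Ported verbatim from the HodgeCMPerL package; no docstring in the source.) -/
theorem charPair_mk_inr_realPlaceCircle (ξ₁ ξ₂ : PontryaginDual (relNormOneIdeles L⁺ L ⧸ relNormOneRat L⁺ L))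
    (b : InfinitePlace L⁺) (u : Circle) :
    charPair ξ₁ ξ₂ (QuotientGroup.mk (inr L⁺ L (realPlaceCircle L b u))) = ξ₂ (realPlaceCircleQuot L b u) := by
  change charPair ξ₁ ξ₂ (QuotientGroup.mk (mk L⁺ L 1 (realPlaceCircle L b u))) = _
  rw [charPair_mk, show (QuotientGroup.mk (1 : relNormOneIdeles L⁺ L) : _ ⧸ relNormOneRat L⁺ L) = 1 from rfl, map_one,
    one_mul]
  rfl

end SeesawTorus

end NumberField

end
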